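import Literature.NumberTheory.Automorphic.UnitaryGroupArthurTruncatedTrace
import Literature.NumberTheory.Automorphic.UnitaryGroupPairKernelSlices
import HarnessLib

/-!
# The pair road `H = U(J_N) × U(Φ₁)`: slice sums of `J^T` and `J` do not depend on the live finite set

[Rogawski1990, §7.3 (p. 98): «`G = U(2) × U(1)`»; §4.9 (pp. 54–55)]. For the endoscopic group
`H = U(J₂) × U(Φ₁)` of `U(3)` the trace formula of `H` is the trace formula of `U(J₂)` applied SLICEWISE: a test
function `f` on `U(J_N)(𝔸) × U(Φ₁)(𝔸)` of compact support has only finitely many non-zero slices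
`f_{γ₁} := f(·, γ₁)`, `γ₁ ∈ U(Φ₁)(L⁺)` (★ `AdelicGroupData.finite_setOf_slice_ne_zero`, the compact factor
`U(Φ₁)(L⁺)∖U(Φ₁)(𝔸)`), the kernel of `H` is `K_H((x₂,x₁),(y₂,x₁)) = Σ_{γ₁} K_{U(J_N)}[f_{γ₁}](x₂,y₂)` (★
`tsum_pair_eq_sum_kernel_slice`, `U(Φ₁)` abelian), and the H-side distributions are WRITTEN (pen-#1 letter WORD #8,
D0.3 — nothing is defined) as `J^T_H(f) = μ₁(U(Φ₁)(L⁺)∖U(Φ₁)(𝔸)) · Σ_{γ₁ ∈ S₁} J^T_{U(J_N)}(f_{γ₁})` and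
`J_H(f) = μ₁(…) · Σ_{γ₁ ∈ S₁} J_{U(J_N)}(f_{γ₁})` for ANY finite set `S₁ ⊇ {γ₁ | f_{γ₁} ≠ 0}`.

This file (part (i) of the step-2 file of the pair road; part (ii), the explicit form of `J_H`, is appended once the
explicit `U(J₂)` formula is in the tree) proves that these spellings do not depend on the choice of `S₁`:

* §1 `arthurTrace_zero` — `J(0) = 0` (with `isTruncatedTracePolynomial_zero`, `truncatedTracePolynomial_zero_fun`;
  ★ `truncatedTrace_zero` is `J^T(0) = 0`).
* §2 (generic second factor `𝒢₁`, any adelic group datum over `F`) `sum_truncatedTrace_slice_eq_of_subset`,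
  `sum_truncatedTrace_slice_eq_of_live`, `sum_arthurTrace_slice_eq_of_subset`, `sum_arthurTrace_slice_eq_of_live` and the
  `μ₁ •` corollaries `smul_sum_truncatedTrace_slice_eq_of_live`, `smul_sum_arthurTrace_slice_eq_of_live`.
* §3 (the CM pair `U(J_N) × U(Φ₁)`) `sum_truncatedTrace_slice_eq_sum_canonical_cm`,
  `sum_arthurTrace_slice_eq_sum_canonical_cm` — every live finite set gives the sum over the canonical finite set of ★
  `UnitaryGroupPairKernelSlices`.

No definitions. [cite: Rogawski1990, §7.3 (p. 98), §4.9 (pp. 54–55), §2.1 (p. 12)] [cite: Shokranian1992, Thm. (5.7) and Rem. (5.8)]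
-/

noncomputable section

open MeasureTheory NumberField IsDedekindDomain Polynomial
open scoped NNReal ENNReal Classical

namespace Literature.NumberTheory.Automorphic

namespace UnitaryGroup

variable {F E : Type} [Field F] [NumberField F] [Field E] [NumberField E] [Algebra F E]
  {c : E ≃ₐ[F] E} {N : ℕ}

/-! ## §1 `J(0) = 0` -/

section Zero

variable [NeZero N] [MeasurableSpace (adelicUnipotent F E c N)]

/-- The zero polynomial computes `J^T(0) = 0` for every `T`. [cite: Rogawski1990, §2.1 (p. 12)] -/
theorem isTruncatedTracePolynomial_zero (μ : Measure (quasiSplit F E c N).automorphicQuotient)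
    (ν : Measure (adelicUnipotent F E c N)) (𝓕 : Set (adelicUnipotent F E c N)) :
    IsTruncatedTracePolynomial μ ν 𝓕 (0 : (quasiSplit F E c N).Adelic → ℂ) 0 :=
  ⟨0, fun T _ => by rw [truncatedTrace_zero, eval_zero]⟩

/-- Arthur's polynomial of the zero test function is `0`. [cite: Shokranian1992, Thm. (5.7) and Rem. (5.8)] -/
theorem truncatedTracePolynomial_zero_fun (μ : Measure (quasiSplit F E c N).automorphicQuotient)
    (ν : Measure (adelicUnipotent F E c N)) (𝓕 : Set (adelicUnipotent F E c N)) :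
    truncatedTracePolynomial μ ν 𝓕 (0 : (quasiSplit F E c N).Adelic → ℂ) = 0 :=
  truncatedTracePolynomial_eq (isTruncatedTracePolynomial_zero μ ν 𝓕)

/-- **`J(0) = 0`.** [cite: Shokranian1992, Thm. (5.7) and Rem. (5.8)] [cite: Rogawski1990, §2.1 (p. 12)] -/
@[simp] theorem arthurTrace_zero (μ : Measure (quasiSplit F E c N).automorphicQuotient)
    (ν : Measure (adelicUnipotent F E c N)) (𝓕 : Set (adelicUnipotent F E c N)) :
    arthurTrace μ ν 𝓕 (0 : (quasiSplit F E c N).Adelic → ℂ) = 0 := by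
  rw [arthurTrace_eq_eval (isTruncatedTracePolynomial_zero μ ν 𝓕), eval_zero]

end Zero

/-! ## §2 Slice sums over a live finite set do not depend on the finite set -/

section Slices

variable [NeZero N] [MeasurableSpace (adelicUnipotent F E c N)] {𝒢₁ : AdelicGroupData F}
  (μ : Measure (quasiSplit F E c N).automorphicQuotient)
  (ν : Measure (adelicUnipotent F E c N)) (𝓕 : Set (adelicUnipotent F E c N))
  {f : (quasiSplit F E c N).Adelic × 𝒢₁.Adelic → ℂ}

/-- **Enlarging a live finite set does not change `Σ_{γ₁} J^T(f_{γ₁})`**: if every `γ₁` with a non-zero slice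
`f_{γ₁} = f(·, γ₁)` lies in `S ⊆ S'`, the slice sums of `J^T` over `S'` and `S` agree (the extra slices are `0` and
`J^T(0) = 0`). [cite: Rogawski1990, §7.3 (p. 98)] [cite: Rogawski1990, §2.1 (p. 12)] -/
theorem sum_truncatedTrace_slice_eq_of_subset {S S' : Finset 𝒢₁.arithmeticSubgroup} (hSS' : S ⊆ S')
    (hS : ∀ γ₁ : 𝒢₁.arithmeticSubgroup,
      (fun g₂ : (quasiSplit F E c N).Adelic => f (g₂, (γ₁ : 𝒢₁.Adelic))) ≠ 0 → γ₁ ∈ S) (T : ℝ≥0) :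
    ∑ γ₁ ∈ S', truncatedTrace μ ν 𝓕 T (fun g₂ : (quasiSplit F E c N).Adelic => f (g₂, (γ₁ : 𝒢₁.Adelic))) =
      ∑ γ₁ ∈ S, truncatedTrace μ ν 𝓕 T (fun g₂ : (quasiSplit F E c N).Adelic => f (g₂, (γ₁ : 𝒢₁.Adelic))) := by
  refine (Finset.sum_subset hSS' fun γ₁ _ hγ₁ => ?_).symm
  have h0 : (fun g₂ : (quasiSplit F E c N).Adelic => f (g₂, (γ₁ : 𝒢₁.Adelic))) = 0 :=
    not_not.1 (mt (hS γ₁) hγ₁)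
  rw [h0, truncatedTrace_zero]

/-- **`Σ_{γ₁ ∈ S₁} J^T(f_{γ₁})` does not depend on the live finite set `S₁`**: two finite sets containing every `γ₁`
with `f_{γ₁} ≠ 0` give the same slice sum (both agree with the sum over `S ∩ S'`). This is the well-definedness of the
written spelling `J^T_H(f) = μ₁ · Σ_{γ₁ ∈ S₁} J^T_{U(J_N)}(f_{γ₁})` of the pair road. [cite: Rogawski1990, §7.3 (p. 98)] -/
theorem sum_truncatedTrace_slice_eq_of_live {S S' : Finset 𝒢₁.arithmeticSubgroup}
    (hS : ∀ γ₁ : 𝒢₁.arithmeticSubgroup,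
      (fun g₂ : (quasiSplit F E c N).Adelic => f (g₂, (γ₁ : 𝒢₁.Adelic))) ≠ 0 → γ₁ ∈ S)
    (hS' : ∀ γ₁ : 𝒢₁.arithmeticSubgroup,
      (fun g₂ : (quasiSplit F E c N).Adelic => f (g₂, (γ₁ : 𝒢₁.Adelic))) ≠ 0 → γ₁ ∈ S') (T : ℝ≥0) :
    ∑ γ₁ ∈ S, truncatedTrace μ ν 𝓕 T (fun g₂ : (quasiSplit F E c N).Adelic => f (g₂, (γ₁ : 𝒢₁.Adelic))) =
      ∑ γ₁ ∈ S', truncatedTrace μ ν 𝓕 T (fun g₂ : (quasiSplit F E c N).Adelic => f (g₂, (γ₁ : 𝒢₁.Adelic))) := by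
  have hI : ∀ γ₁ : 𝒢₁.arithmeticSubgroup,
      (fun g₂ : (quasiSplit F E c N).Adelic => f (g₂, (γ₁ : 𝒢₁.Adelic))) ≠ 0 → γ₁ ∈ S ∩ S' :=
    fun γ₁ h => Finset.mem_inter.2 ⟨hS γ₁ h, hS' γ₁ h⟩
  rw [sum_truncatedTrace_slice_eq_of_subset μ ν 𝓕 Finset.inter_subset_left hI T,
    sum_truncatedTrace_slice_eq_of_subset μ ν 𝓕 Finset.inter_subset_right hI T]

/-- **Enlarging a live finite set does not change `Σ_{γ₁} J(f_{γ₁})`** (`J(0) = 0`, §1).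
[cite: Rogawski1990, §7.3 (p. 98)] [cite: Shokranian1992, Thm. (5.7) and Rem. (5.8)] -/
theorem sum_arthurTrace_slice_eq_of_subset {S S' : Finset 𝒢₁.arithmeticSubgroup} (hSS' : S ⊆ S')
    (hS : ∀ γ₁ : 𝒢₁.arithmeticSubgroup,
      (fun g₂ : (quasiSplit F E c N).Adelic => f (g₂, (γ₁ : 𝒢₁.Adelic))) ≠ 0 → γ₁ ∈ S) :
    ∑ γ₁ ∈ S', arthurTrace μ ν 𝓕 (fun g₂ : (quasiSplit F E c N).Adelic => f (g₂, (γ₁ : 𝒢₁.Adelic))) =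
      ∑ γ₁ ∈ S, arthurTrace μ ν 𝓕 (fun g₂ : (quasiSplit F E c N).Adelic => f (g₂, (γ₁ : 𝒢₁.Adelic))) := by
  refine (Finset.sum_subset hSS' fun γ₁ _ hγ₁ => ?_).symm
  have h0 : (fun g₂ : (quasiSplit F E c N).Adelic => f (g₂, (γ₁ : 𝒢₁.Adelic))) = 0 :=
    not_not.1 (mt (hS γ₁) hγ₁)
  rw [h0, arthurTrace_zero]

/-- **`Σ_{γ₁ ∈ S₁} J(f_{γ₁})` does not depend on the live finite set `S₁`** — the well-definedness of the written
spelling `J_H(f) = μ₁ · Σ_{γ₁ ∈ S₁} J_{U(J_N)}(f_{γ₁})` of the pair road. [cite: Rogawski1990, §7.3 (p. 98)] -/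
theorem sum_arthurTrace_slice_eq_of_live {S S' : Finset 𝒢₁.arithmeticSubgroup}
    (hS : ∀ γ₁ : 𝒢₁.arithmeticSubgroup,
      (fun g₂ : (quasiSplit F E c N).Adelic => f (g₂, (γ₁ : 𝒢₁.Adelic))) ≠ 0 → γ₁ ∈ S)
    (hS' : ∀ γ₁ : 𝒢₁.arithmeticSubgroup,
      (fun g₂ : (quasiSplit F E c N).Adelic => f (g₂, (γ₁ : 𝒢₁.Adelic))) ≠ 0 → γ₁ ∈ S') :
    ∑ γ₁ ∈ S, arthurTrace μ ν 𝓕 (fun g₂ : (quasiSplit F E c N).Adelic => f (g₂, (γ₁ : 𝒢₁.Adelic))) =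
      ∑ γ₁ ∈ S', arthurTrace μ ν 𝓕 (fun g₂ : (quasiSplit F E c N).Adelic => f (g₂, (γ₁ : 𝒢₁.Adelic))) := by
  have hI : ∀ γ₁ : 𝒢₁.arithmeticSubgroup,
      (fun g₂ : (quasiSplit F E c N).Adelic => f (g₂, (γ₁ : 𝒢₁.Adelic))) ≠ 0 → γ₁ ∈ S ∩ S' :=
    fun γ₁ h => Finset.mem_inter.2 ⟨hS γ₁ h, hS' γ₁ h⟩
  rw [sum_arthurTrace_slice_eq_of_subset μ ν 𝓕 Finset.inter_subset_left hI,
    sum_arthurTrace_slice_eq_of_subset μ ν 𝓕 Finset.inter_subset_right hI]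

/-- The written `J^T_H(f) = μ₁(X₁) · Σ_{γ₁ ∈ S₁} J^T(f_{γ₁})` (`μ₁` the finite invariant measure of the compact
factor `X₁ = 𝒢₁(F)∖𝒢₁(𝔸)`) does not depend on the live finite set `S₁`. [cite: Rogawski1990, §7.3 (p. 98)] -/
theorem smul_sum_truncatedTrace_slice_eq_of_live (μ₁ : Measure 𝒢₁.automorphicQuotient)
    {S S' : Finset 𝒢₁.arithmeticSubgroup}
    (hS : ∀ γ₁ : 𝒢₁.arithmeticSubgroup,
      (fun g₂ : (quasiSplit F E c N).Adelic => f (g₂, (γ₁ : 𝒢₁.Adelic))) ≠ 0 → γ₁ ∈ S)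
    (hS' : ∀ γ₁ : 𝒢₁.arithmeticSubgroup,
      (fun g₂ : (quasiSplit F E c N).Adelic => f (g₂, (γ₁ : 𝒢₁.Adelic))) ≠ 0 → γ₁ ∈ S') (T : ℝ≥0) :
    (μ₁.real Set.univ : ℝ) • ∑ γ₁ ∈ S, truncatedTrace μ ν 𝓕 T
        (fun g₂ : (quasiSplit F E c N).Adelic => f (g₂, (γ₁ : 𝒢₁.Adelic))) =
      (μ₁.real Set.univ : ℝ) • ∑ γ₁ ∈ S', truncatedTrace μ ν 𝓕 T
        (fun g₂ : (quasiSplit F E c N).Adelic => f (g₂, (γ₁ : 𝒢₁.Adelic))) := by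
  rw [sum_truncatedTrace_slice_eq_of_live μ ν 𝓕 hS hS' T]

/-- The written `J_H(f) = μ₁(X₁) · Σ_{γ₁ ∈ S₁} J(f_{γ₁})` does not depend on the live finite set `S₁`.
[cite: Rogawski1990, §7.3 (p. 98)] -/
theorem smul_sum_arthurTrace_slice_eq_of_live (μ₁ : Measure 𝒢₁.automorphicQuotient)
    {S S' : Finset 𝒢₁.arithmeticSubgroup}
    (hS : ∀ γ₁ : 𝒢₁.arithmeticSubgroup,
      (fun g₂ : (quasiSplit F E c N).Adelic => f (g₂, (γ₁ : 𝒢₁.Adelic))) ≠ 0 → γ₁ ∈ S)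
    (hS' : ∀ γ₁ : 𝒢₁.arithmeticSubgroup,
      (fun g₂ : (quasiSplit F E c N).Adelic => f (g₂, (γ₁ : 𝒢₁.Adelic))) ≠ 0 → γ₁ ∈ S') :
    (μ₁.real Set.univ : ℝ) • ∑ γ₁ ∈ S, arthurTrace μ ν 𝓕
        (fun g₂ : (quasiSplit F E c N).Adelic => f (g₂, (γ₁ : 𝒢₁.Adelic))) =
      (μ₁.real Set.univ : ℝ) • ∑ γ₁ ∈ S', arthurTrace μ ν 𝓕
        (fun g₂ : (quasiSplit F E c N).Adelic => f (g₂, (γ₁ : 𝒢₁.Adelic))) := by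
  rw [sum_arthurTrace_slice_eq_of_live μ ν 𝓕 hS hS']

end Slices

/-! ## §3 The CM pair `U(J_N) × U(Φ₁)`: every live finite set gives the canonical slice sum -/

section CMPair

variable (L : Type) [Field L] [NumberField L] [IsCMField L] (Φ₁ : Matrix (Fin 1) (Fin 1) L) [NeZero N]
  [MeasurableSpace (adelicUnipotent (↥(maximalRealSubfield L)) L (IsCMField.complexConj L) N)]
  (μ : Measure (quasiSplit (↥(maximalRealSubfield L)) L (IsCMField.complexConj L) N).automorphicQuotient)
  (ν : Measure (adelicUnipotent (↥(maximalRealSubfield L)) L (IsCMField.complexConj L) N))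
  (𝓕 : Set (adelicUnipotent (↥(maximalRealSubfield L)) L (IsCMField.complexConj L) N))
  {f : (quasiSplit (↥(maximalRealSubfield L)) L (IsCMField.complexConj L) N).Adelic × (cmDatum L 1 Φ₁).Adelic → ℂ}

omit [NeZero N] [MeasurableSpace (adelicUnipotent (↥(maximalRealSubfield L)) L (IsCMField.complexConj L) N)] in
/-- For the pair `U(J_N) × U(Φ₁)` over a CM field `L` and `f` of compact support, the canonical finite set
`S₁(x₁) = {γ₁ ∈ U(Φ₁)(L⁺) | f(·, x₁⁻¹ γ₁ x₁) ≠ 0}` of ★ `AdelicGroupData.finite_setOf_slice_ne_zero` is live: it contains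
every `γ₁` with `f_{γ₁} ≠ 0` (`U(Φ₁)` is abelian, ★ `cmDatum_one_mul_comm`). [cite: Rogawski1990, §4.9 pp. 54–55] -/
theorem mem_toFinset_slice_ne_zero_cm (hf : HasCompactSupport f) (x₁ : (cmDatum L 1 Φ₁).Adelic)
    (γ₁ : (cmDatum L 1 Φ₁).arithmeticSubgroup)
    (hγ₁ : (fun g₂ : (quasiSplit (↥(maximalRealSubfield L)) L (IsCMField.complexConj L) N).Adelic =>
      f (g₂, (γ₁ : (cmDatum L 1 Φ₁).Adelic))) ≠ 0) :
    γ₁ ∈ (AdelicGroupData.finite_setOf_slice_ne_zero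
      (𝒢₂ := quasiSplit (↥(maximalRealSubfield L)) L (IsCMField.complexConj L) N)
      (cmDatum_isDiscreteRational L 1 Φ₁) hf x₁ x₁).toFinset :=
  (AdelicGroupData.mem_toFinset_slice_ne_zero_of_comm (cmDatum_isDiscreteRational L 1 Φ₁)
    (cmDatum_one_mul_comm L Φ₁) hf x₁ γ₁).2 hγ₁

/-- **`Σ_{γ₁ ∈ S₁} J^T(f_{γ₁})` over ANY live finite set `S₁` is the sum over the canonical finite set** of ★
`UnitaryGroupPairKernelSlices` (pair `U(J_N) × U(Φ₁)` over a CM field, `f` of compact support).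
[cite: Rogawski1990, §7.3 (p. 98)] [cite: Rogawski1990, §4.9 pp. 54–55] -/
theorem sum_truncatedTrace_slice_eq_sum_canonical_cm (hf : HasCompactSupport f) (x₁ : (cmDatum L 1 Φ₁).Adelic)
    {S : Finset (cmDatum L 1 Φ₁).arithmeticSubgroup}
    (hS : ∀ γ₁ : (cmDatum L 1 Φ₁).arithmeticSubgroup,
      (fun g₂ : (quasiSplit (↥(maximalRealSubfield L)) L (IsCMField.complexConj L) N).Adelic =>
        f (g₂, (γ₁ : (cmDatum L 1 Φ₁).Adelic))) ≠ 0 → γ₁ ∈ S) (T : ℝ≥0) :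
    ∑ γ₁ ∈ S, truncatedTrace μ ν 𝓕 T
        (fun g₂ : (quasiSplit (↥(maximalRealSubfield L)) L (IsCMField.complexConj L) N).Adelic =>
          f (g₂, (γ₁ : (cmDatum L 1 Φ₁).Adelic))) =
      ∑ γ₁ ∈ (AdelicGroupData.finite_setOf_slice_ne_zero
          (𝒢₂ := quasiSplit (↥(maximalRealSubfield L)) L (IsCMField.complexConj L) N)
          (cmDatum_isDiscreteRational L 1 Φ₁) hf x₁ x₁).toFinset,
        truncatedTrace μ ν 𝓕 T
          (fun g₂ : (quasiSplit (↥(maximalRealSubfield L)) L (IsCMField.complexConj L) N).Adelic =>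
            f (g₂, (γ₁ : (cmDatum L 1 Φ₁).Adelic))) :=
  sum_truncatedTrace_slice_eq_of_live μ ν 𝓕 hS (mem_toFinset_slice_ne_zero_cm L Φ₁ hf x₁) T

/-- **`Σ_{γ₁ ∈ S₁} J(f_{γ₁})` over ANY live finite set `S₁` is the sum over the canonical finite set** of ★
`UnitaryGroupPairKernelSlices` (pair `U(J_N) × U(Φ₁)` over a CM field, `f` of compact support) — so the written
`J_H(f) = μ₁ · Σ_{γ₁ ∈ S₁} J_{U(J_N)}(f_{γ₁})` is one number. [cite: Rogawski1990, §7.3 (p. 98)] [cite: Rogawski1990, §4.9 pp. 54–55] -/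
theorem sum_arthurTrace_slice_eq_sum_canonical_cm (hf : HasCompactSupport f) (x₁ : (cmDatum L 1 Φ₁).Adelic)
    {S : Finset (cmDatum L 1 Φ₁).arithmeticSubgroup}
    (hS : ∀ γ₁ : (cmDatum L 1 Φ₁).arithmeticSubgroup,
      (fun g₂ : (quasiSplit (↥(maximalRealSubfield L)) L (IsCMField.complexConj L) N).Adelic =>
        f (g₂, (γ₁ : (cmDatum L 1 Φ₁).Adelic))) ≠ 0 → γ₁ ∈ S) :
    ∑ γ₁ ∈ S, arthurTrace μ ν 𝓕
        (fun g₂ : (quasiSplit (↥(maximalRealSubfield L)) L (IsCMField.complexConj L) N).Adelic =>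
          f (g₂, (γ₁ : (cmDatum L 1 Φ₁).Adelic))) =
      ∑ γ₁ ∈ (AdelicGroupData.finite_setOf_slice_ne_zero
          (𝒢₂ := quasiSplit (↥(maximalRealSubfield L)) L (IsCMField.complexConj L) N)
          (cmDatum_isDiscreteRational L 1 Φ₁) hf x₁ x₁).toFinset,
        arthurTrace μ ν 𝓕
          (fun g₂ : (quasiSplit (↥(maximalRealSubfield L)) L (IsCMField.complexConj L) N).Adelic =>
            f (g₂, (γ₁ : (cmDatum L 1 Φ₁).Adelic))) :=
  sum_arthurTrace_slice_eq_of_live μ ν 𝓕 hS (mem_toFinset_slice_ne_zero_cm L Φ₁ hf x₁)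

end CMPair

end UnitaryGroup

end Literature.NumberTheory.Automorphic
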